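import Summits.CriticalPhenomena.PercolationContinuityZ3.Theorems.PercNearOneGluingNoHeavyLowerTailSahiPivotDichotomyCompositeWitness
import Mathlib
import HarnessLib
import HarnessLib.Audit.Tags

/-!
# `NoHeavyLowerTail` (crux stmt-CriticalPhenomena-4575), master-family line P1 (gen 20):
# the OR-BLOCK CALCULUS identity is a THEOREM — hence `¬ PivotDichotomy 3` UNCONDITIONALLY, and `PivotDichotomy k ↔ k ≤ 2`

Support file (seat `prim-masterthm-p1`, gen 20; `--supports stmt-CriticalPhenomena-4575`), on top of `…SahiPivotDichotomyCompositeWitness`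
(gen 19: typed hypothesis `OrBlockCalculus`, kernel-evaluated witness values, `not_pivotDichotomy_three_of_orBlockCalculus`).
Memo `run/shared/lean/prim/prim-masterthm/FROM-prim-masterthm-p1-g20-*.md`; plan `prim-masterthm-p1/code-g19/ORBLOCKCALCULUS-PLAN.md`.
1. A general ORDERED-TRIPARTITION SUM `tripSum S h = Σ_{W ⊆ S} Σ_{X ⊆ S∖W} h W X (S∖W∖X)` and its calculus: one-coordinate split
   (`tripSum_insert`), DISJOINT-UNION split into a double tripartition sum (`tripSum_union`), linearity (`tripSum_sum_mul`), and the
   ONE-BLOCK PATTERN COUNT (`tripSum_nonempty_pattern`): over the ordered tripartitions of a nonempty `n`-block a summand that sees the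
   cells only through "empty or not" sums to `Σ_{β ∈ {0,1}³} orStat n |β| · G β`, `orStat n c = (0, 1, 2ⁿ−2, 3ⁿ−3·2ⁿ+3)_c` (recurrence in `n`).
2. **`tripSum_orComposite_eq`**: for pairwise disjoint nonempty blocks `B 0 … B (m−1)` and ANY `g`,
   `Σ_{(W,X,Y) ⊢ ⋃ B j} g (pat W) (pat X) (pat Y) = Σ_{x,y,z ⊆ range m} (Π_j orStat |B j| #{x,y,z ∋ j}) · g x y z`, `pat W = {j : W meets B j}`
   (induction on `m`: peel the last block, regroup its tripartitions by hit pattern, expand the weighted sum along the last meta-coordinate).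
3. **`orBlockCalculus_holds : OrBlockCalculus`**, hence **`not_pivotDichotomy_three : ¬ PivotDichotomy 3`** WITHOUT HYPOTHESES (gen 16's
   one-payer dichotomy "on every pure fibre the core pivots alone or the outside pivots alone pay for all rainbows" fails on the monotone
   labeling `orComposite 5 blk F0c` of 19 coordinates: `T = 32 555 232 > 3S_A = 32 511 888 > 3S_B = 30 348 288`; everything implying
   `PivotDichotomy 3`, e.g. `LCExmax 3`, falls again — cf. the tree's `not_lcExmax_three`), and the complete picture
   **`pivotDichotomy_iff_le_two : PivotDichotomy k ↔ k ≤ 2`** (petal embedding `Fin 3 ↪ Fin k`; for `k ≤ 2` there are no rainbows).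
NOT TOUCHED: CP3⁺ (`T ≤ 3S_A + 3S_B` holds for the witness), S₃^max (`StrongCubicMaxNonneg`), S₃, the class law.
HONEST FRAMING: a routine counting identity, formalized; its payload is that the refutation of the typed `PivotDichotomy` is unconditional. [this work]
-/

namespace Summit.CriticalPhenomena.PercolationContinuityZ3.Theorems

namespace SahiPivotFamily

open Finset AntipodalStrongHarris AntipodalStrongHarris.Lab

variable {α : Type*} [DecidableEq α]

/-! ### 1. Ordered-tripartition sums of a general three-set function -/

/-- **Ordered-tripartition sum** of a three-set function: `Σ_{W ⊆ S} Σ_{X ⊆ S ∖ W} h W X (S ∖ W ∖ X)`. [this work] -/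
def tripSum (S : Finset α) (h : Finset α → Finset α → Finset α → ℤ) : ℤ :=
  ∑ W ∈ S.powerset, ∑ X ∈ (S \ W).powerset, h W X ((S \ W) \ X)

/-- Pointwise congruence on ordered tripartitions. [this work] -/
theorem tripSum_congr {S : Finset α} {h h' : Finset α → Finset α → Finset α → ℤ}
    (H : ∀ W X, W ⊆ S → X ⊆ S \ W → h W X ((S \ W) \ X) = h' W X ((S \ W) \ X)) :
    tripSum S h = tripSum S h' :=
  sum_congr rfl fun W hW => sum_congr rfl fun X hX => H W X (mem_powerset.mp hW) (mem_powerset.mp hX)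

/-- The empty ground set has the single tripartition `(∅, ∅, ∅)`. [this work] -/
theorem tripSum_empty (h : Finset α → Finset α → Finset α → ℤ) : tripSum (∅ : Finset α) h = h ∅ ∅ ∅ := by
  simp [tripSum]

/-- **Splitting off one coordinate**: a tripartition of `S ∪ {e}` is a tripartition of `S` plus the cell of `e`. [this work] -/
theorem tripSum_insert (S : Finset α) {e : α} (he : e ∉ S) (h : Finset α → Finset α → Finset α → ℤ) :
    tripSum (insert e S) h =
      tripSum S (fun W X Y => h (insert e W) X Y + h W (insert e X) Y + h W X (insert e Y)) := by
  unfold tripSum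
  rw [sum_powerset_insert he]
  have h1 : ∀ W ∈ S.powerset, ∑ X ∈ (insert e S \ W).powerset, h W X ((insert e S \ W) \ X) =
      ∑ X ∈ (S \ W).powerset, (h W (insert e X) ((S \ W) \ X) + h W X (insert e ((S \ W) \ X))) := by
    intro W hW
    have hWS : W ⊆ S := mem_powerset.mp hW
    have heW : e ∉ W := fun h' => he (hWS h')
    have heSW : e ∉ S \ W := fun h' => he (mem_sdiff.mp h').1
    rw [insert_sdiff_of_notMem S heW, sum_powerset_insert heSW, ← sum_add_distrib]
    refine sum_congr rfl fun X hX => ?_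
    have hXS : X ⊆ S \ W := mem_powerset.mp hX
    have heX : e ∉ X := fun h' => heSW (hXS h')
    rw [insert_sdiff_of_notMem _ heX, insert_sdiff_insert, sdiff_insert_of_notMem heSW, add_comm]
  have h2 : ∀ W ∈ S.powerset,
      ∑ X ∈ (insert e S \ insert e W).powerset, h (insert e W) X ((insert e S \ insert e W) \ X) =
        ∑ X ∈ (S \ W).powerset, h (insert e W) X ((S \ W) \ X) := by
    intro W _
    rw [insert_sdiff_insert, sdiff_insert_of_notMem he]
  rw [sum_congr rfl h1, sum_congr rfl h2, ← sum_add_distrib]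
  refine sum_congr rfl fun W _ => ?_
  rw [← sum_add_distrib]
  refine sum_congr rfl fun X _ => ?_
  ring

/-- **Disjoint-union decomposition**: an ordered tripartition of `S ∪ B` (`S`, `B` disjoint) is a pair of ordered tripartitions
of `S` and of `B`, cellwise united. [this work] -/
theorem tripSum_union (S B : Finset α) (hSB : Disjoint S B) (h : Finset α → Finset α → Finset α → ℤ) :
    tripSum (S ∪ B) h =
      tripSum S (fun W₁ X₁ Y₁ => tripSum B (fun W₂ X₂ Y₂ => h (W₁ ∪ W₂) (X₁ ∪ X₂) (Y₁ ∪ Y₂))) := by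
  induction B using Finset.induction_on generalizing h with
  | empty => simp [tripSum_empty]
  | insert e B heB ih =>
    obtain ⟨heS, hSB'⟩ := disjoint_insert_right.mp hSB
    have heSB : e ∉ S ∪ B := by rw [mem_union, not_or]; exact ⟨heS, heB⟩
    rw [union_insert, tripSum_insert (S ∪ B) heSB, ih hSB']
    simp only [tripSum_insert B heB, union_insert]

/-- **Linearity**: a finite linear combination inside the summand comes out. [this work] -/
theorem tripSum_sum_mul {ι : Type*} (S : Finset α) (T : Finset ι) (c : ι → ℤ)
    (F : ι → Finset α → Finset α → Finset α → ℤ) :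
    tripSum S (fun W X Y => ∑ i ∈ T, c i * F i W X Y) = ∑ i ∈ T, c i * tripSum S (F i) := by
  unfold tripSum
  have hW : ∀ W ∈ S.powerset, (∑ X ∈ (S \ W).powerset, ∑ i ∈ T, c i * F i W X ((S \ W) \ X)) =
      ∑ i ∈ T, ∑ X ∈ (S \ W).powerset, c i * F i W X ((S \ W) \ X) := fun W _ => sum_comm
  rw [sum_congr rfl hW, sum_comm]
  simp only [mul_sum]

/-! ### 2. The one-block pattern count -/

/-- Number of `true`s among three Booleans. [this work] -/
def nTrue (b₁ b₂ b₃ : Bool) : ℕ := b₁.toNat + b₂.toNat + b₃.toNat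

/-- **One-block pattern count.**  If the summand sees the three cells only through "empty or not", the ordered-tripartition sum
of a NONEMPTY block of size `n` is `Σ_{β ∈ {0,1}³} orStat n |β| · G β`: the number of ordered tripartitions of an `n`-set meeting
exactly a prescribed set of `c` cells is `orStat n c = (0, 1, 2ⁿ − 2, 3ⁿ − 3·2ⁿ + 3)_c` (`c = 0,1,2,3`).  Proof by the recurrence in
`n` (adding a point to the block puts it into one of the three cells). [this work] -/
theorem tripSum_nonempty_pattern (B : Finset α) (hB : B.Nonempty) (G : Bool → Bool → Bool → ℤ) :
    tripSum B (fun W X Y => G (decide W.Nonempty) (decide X.Nonempty) (decide Y.Nonempty)) =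
      ∑ b : Bool × Bool × Bool, orStat B.card (nTrue b.1 b.2.1 b.2.2) * G b.1 b.2.1 b.2.2 := by
  induction B using Finset.induction_on generalizing G with
  | empty => exact absurd hB (by simp)
  | insert e B heB ih =>
    rw [tripSum_insert B heB, card_insert_of_notMem heB]
    simp only [insert_nonempty, decide_true]
    rcases B.eq_empty_or_nonempty with rfl | hne
    · rw [tripSum_empty]
      simp only [Finset.not_nonempty_empty, decide_false, card_empty, zero_add, Fintype.sum_prod_type,
        Fintype.sum_bool, nTrue, Bool.toNat_true, Bool.toNat_false, orStat]
      norm_num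
      ring
    · rw [ih hne (fun b₁ b₂ b₃ => G true b₂ b₃ + G b₁ true b₃ + G b₁ b₂ true)]
      simp only [Fintype.sum_prod_type, Fintype.sum_bool, nTrue, Bool.toNat_true, Bool.toNat_false, orStat]
      norm_num
      ring

/-! ### 3. Hit patterns along pairwise disjoint blocks -/

/-- **Hit pattern** of a set along the blocks `B 0, …, B (m−1)`: the meta-coordinates `j < m` whose block it meets
(so that `orComposite m B F₀ X = F₀ (hitPat m B X)` by definition). [this work] -/
def hitPat (m : ℕ) (B : ℕ → Finset ℕ) (W : Finset ℕ) : Finset ℕ := (range m).filter fun j => (W ∩ B j).Nonempty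

/-- Membership in the hit pattern. [this work] -/
theorem mem_hitPat {m : ℕ} {B : ℕ → Finset ℕ} {W : Finset ℕ} {j : ℕ} :
    j ∈ hitPat m B W ↔ j < m ∧ (W ∩ B j).Nonempty := by
  rw [hitPat, mem_filter, mem_range]

/-- Extending a pattern by the meta-coordinate `m` or not, according to a Boolean. [this work] -/
def bext (m : ℕ) (x : Finset ℕ) : Bool → Finset ℕ
  | true => insert m x
  | false => x

/-- The last block is disjoint from the union of the earlier ones. [this work] -/
theorem disjoint_biUnion_block {m : ℕ} {B : ℕ → Finset ℕ}
    (hdisj : ∀ i < m + 1, ∀ j < m + 1, i ≠ j → Disjoint (B i) (B j)) :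
    Disjoint ((range m).biUnion B) (B m) := by
  rw [disjoint_biUnion_left]
  intro i hi
  exact hdisj i (by rw [mem_range] at hi; omega) m (by omega) (by rw [mem_range] at hi; omega)

/-- **Hit pattern of a cellwise union**: for `W₁` inside the first `m` blocks and `W₂ ⊆ B m`, the pattern of `W₁ ∪ W₂` along
`m + 1` blocks is the pattern of `W₁` along `m` blocks, extended by `m` iff `W₂ ≠ ∅`. [this work] -/
theorem hitPat_union {m : ℕ} {B : ℕ → Finset ℕ}
    (hdisj : ∀ i < m + 1, ∀ j < m + 1, i ≠ j → Disjoint (B i) (B j))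
    {W₁ W₂ : Finset ℕ} (hW₁ : W₁ ⊆ (range m).biUnion B) (hW₂ : W₂ ⊆ B m) :
    hitPat (m + 1) B (W₁ ∪ W₂) = bext m (hitPat m B W₁) (decide W₂.Nonempty) := by
  have h1 : ∀ j, j ≠ m → j < m + 1 → W₂ ∩ B j = ∅ := by
    intro j hj hjm
    have hd := hdisj m (by omega) j hjm (Ne.symm hj)
    exact disjoint_iff_inter_eq_empty.mp (disjoint_of_subset_left hW₂ hd)
  have h2 : W₁ ∩ B m = ∅ :=
    disjoint_iff_inter_eq_empty.mp (disjoint_of_subset_left hW₁ (disjoint_biUnion_block hdisj))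
  by_cases hne : W₂.Nonempty
  · rw [decide_eq_true hne]
    show hitPat (m + 1) B (W₁ ∪ W₂) = insert m (hitPat m B W₁)
    ext j
    rw [mem_hitPat, mem_insert, mem_hitPat]
    constructor
    · rintro ⟨hj, hjn⟩
      by_cases hjm : j = m
      · exact Or.inl hjm
      · right
        refine ⟨by omega, ?_⟩
        rwa [union_inter_distrib_right, h1 j hjm hj, union_empty] at hjn
    · rintro (rfl | ⟨hj, hjn⟩)
      · refine ⟨by omega, ?_⟩
        rw [union_inter_distrib_right, h2, empty_union, inter_eq_left.mpr hW₂]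
        exact hne
      · refine ⟨by omega, ?_⟩
        rw [union_inter_distrib_right]
        exact hjn.mono subset_union_left
  · rw [decide_eq_false hne]
    show hitPat (m + 1) B (W₁ ∪ W₂) = hitPat m B W₁
    rw [not_nonempty_iff_eq_empty.mp hne, union_empty]
    ext j
    rw [mem_hitPat, mem_hitPat]
    constructor
    · rintro ⟨hj, hjn⟩
      refine ⟨?_, hjn⟩
      by_contra hjm
      obtain rfl : j = m := by omega
      exact Finset.not_nonempty_empty (h2 ▸ hjn)
    · exact fun ⟨hj, hjn⟩ => ⟨by omega, hjn⟩

/-! ### 4. The weighted side: peeling the last meta-coordinate -/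

/-- The coordinatewise triple weight along `m + 1` meta-coordinates factors through the extension bits at `m`. [this work] -/
theorem tripleWeightInt_bext {m : ℕ} (wz : ℕ → ℕ → ℤ) {x y z : Finset ℕ}
    (hx : x ⊆ range m) (hy : y ⊆ range m) (hz : z ⊆ range m) (b₁ b₂ b₃ : Bool) :
    tripleWeightInt (range (m + 1)) wz (bext m x b₁) (bext m y b₂) (bext m z b₃) =
      wz m (nTrue b₁ b₂ b₃) * tripleWeightInt (range m) wz x y z := by
  unfold tripleWeightInt
  rw [range_add_one, prod_insert notMem_range_self]
  have hxm : m ∉ x := fun h => notMem_range_self (hx h); have hym : m ∉ y := fun h => notMem_range_self (hy h)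
  have hzm : m ∉ z := fun h => notMem_range_self (hz h)
  congr 1
  · cases b₁ <;> cases b₂ <;> cases b₃ <;> simp [bext, nTrue, hxm, hym, hzm]
  · refine prod_congr rfl fun j hj => ?_
    have hjm : j ≠ m := by rw [mem_range] at hj; omega
    have key : ∀ (w : Finset ℕ) (b : Bool), (if j ∈ bext m w b then (1 : ℕ) else 0) = if j ∈ w then 1 else 0 := by
      intro w b
      cases b
      · rfl
      · by_cases hjw : j ∈ w <;> simp [bext, hjw, hjm]
    rw [key x b₁, key y b₂, key z b₃]

/-- Expanding a triple sum over the subsets of `range (m + 1)` along the membership of `m`. [this work] -/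
theorem sum3_powerset_range_succ {m : ℕ} (Φ : Finset ℕ → Finset ℕ → Finset ℕ → ℤ) :
    ∑ x ∈ (range (m + 1)).powerset, ∑ y ∈ (range (m + 1)).powerset, ∑ z ∈ (range (m + 1)).powerset, Φ x y z =
      ∑ b : Bool × Bool × Bool, ∑ x ∈ (range m).powerset, ∑ y ∈ (range m).powerset, ∑ z ∈ (range m).powerset,
        Φ (bext m x b.1) (bext m y b.2.1) (bext m z b.2.2) := by
  rw [range_add_one]
  simp only [sum_powerset_insert notMem_range_self, sum_add_distrib, Fintype.sum_prod_type, Fintype.sum_bool, bext]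
  abel

/-! ### 5. The OR-block calculus identity -/

/-- **THEOREM (OR-block calculus, general form).**  For pairwise disjoint nonempty blocks `B 0, …, B (m−1)` and any three-pattern
function `g`: `Σ_{(W,X,Y) ⊢ ⋃_j B j} g (pat W) (pat X) (pat Y) = Σ_{x,y,z ⊆ range m} (Π_{j<m} orStat |B j| #{x,y,z ∋ j}) · g x y z`
— ordered tripartitions of the union are tuples of block tripartitions, and those with a prescribed hit pattern are counted
blockwise by `orStat`. [this work] -/
theorem tripSum_orComposite_eq (m : ℕ) (B : ℕ → Finset ℕ)
    (hdisj : ∀ i < m, ∀ j < m, i ≠ j → Disjoint (B i) (B j)) (hne : ∀ j < m, (B j).Nonempty)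
    (g : Finset ℕ → Finset ℕ → Finset ℕ → ℤ) :
    tripSum ((range m).biUnion B) (fun W X Y => g (hitPat m B W) (hitPat m B X) (hitPat m B Y)) =
      ∑ x ∈ (range m).powerset, ∑ y ∈ (range m).powerset, ∑ z ∈ (range m).powerset,
        tripleWeightInt (range m) (fun j => orStat (B j).card) x y z * g x y z := by
  induction m generalizing g with
  | zero =>
    simp [tripSum_empty, hitPat, tripleWeightInt]
  | succ m ih =>
    have hdisj' : ∀ i < m, ∀ j < m, i ≠ j → Disjoint (B i) (B j) :=
      fun i hi j hj hij => hdisj i (by omega) j (by omega) hij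
    have hne' : ∀ j < m, (B j).Nonempty := fun j hj => hne j (by omega)
    have hD : Disjoint ((range m).biUnion B) (B m) := disjoint_biUnion_block hdisj
    have hBm : (B m).Nonempty := hne m (by omega)
    conv_lhs => rw [range_add_one, biUnion_insert, union_comm]
    rw [tripSum_union _ _ hD]
    -- regroup the tripartitions of the last block by hit pattern
    have step12 : tripSum ((range m).biUnion B) (fun W₁ X₁ Y₁ => tripSum (B m) (fun W₂ X₂ Y₂ =>
          g (hitPat (m + 1) B (W₁ ∪ W₂)) (hitPat (m + 1) B (X₁ ∪ X₂)) (hitPat (m + 1) B (Y₁ ∪ Y₂)))) =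
        tripSum ((range m).biUnion B) (fun W₁ X₁ Y₁ => ∑ b : Bool × Bool × Bool,
          orStat (B m).card (nTrue b.1 b.2.1 b.2.2) *
            g (bext m (hitPat m B W₁) b.1) (bext m (hitPat m B X₁) b.2.1) (bext m (hitPat m B Y₁) b.2.2)) := by
      refine tripSum_congr fun W₁ X₁ hW₁ hX₁ => ?_
      have hX₁' : X₁ ⊆ (range m).biUnion B := hX₁.trans sdiff_subset
      have hY₁' : ((range m).biUnion B \ W₁) \ X₁ ⊆ (range m).biUnion B := sdiff_subset.trans sdiff_subset
      refine Eq.trans ?_ (tripSum_nonempty_pattern (B m) hBm (fun b₁ b₂ b₃ =>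
        g (bext m (hitPat m B W₁) b₁) (bext m (hitPat m B X₁) b₂)
          (bext m (hitPat m B (((range m).biUnion B \ W₁) \ X₁)) b₃)))
      refine tripSum_congr fun W₂ X₂ hW₂ hX₂ => ?_
      have hX₂' : X₂ ⊆ B m := hX₂.trans sdiff_subset
      have hY₂' : (B m \ W₂) \ X₂ ⊆ B m := sdiff_subset.trans sdiff_subset
      rw [hitPat_union hdisj hW₁ hW₂, hitPat_union hdisj hX₁' hX₂', hitPat_union hdisj hY₁' hY₂']
    have step3 : ∀ b : Bool × Bool × Bool, tripSum ((range m).biUnion B) (fun W X Y =>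
          g (bext m (hitPat m B W) b.1) (bext m (hitPat m B X) b.2.1) (bext m (hitPat m B Y) b.2.2)) =
        ∑ x ∈ (range m).powerset, ∑ y ∈ (range m).powerset, ∑ z ∈ (range m).powerset,
          tripleWeightInt (range m) (fun j => orStat (B j).card) x y z *
            g (bext m x b.1) (bext m y b.2.1) (bext m z b.2.2) :=
      fun b => ih hdisj' hne' (fun x y z => g (bext m x b.1) (bext m y b.2.1) (bext m z b.2.2))
    rw [step12, tripSum_sum_mul]
    simp only [step3]
    rw [sum3_powerset_range_succ]
    refine sum_congr rfl fun b _ => ?_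
    rw [mul_sum]; refine sum_congr rfl fun x hx => ?_
    rw [mul_sum]; refine sum_congr rfl fun y hy => ?_
    rw [mul_sum]; refine sum_congr rfl fun z hz => ?_
    rw [tripleWeightInt_bext _ (mem_powerset.mp hx) (mem_powerset.mp hy) (mem_powerset.mp hz)]
    ring

/-! ### 6. `OrBlockCalculus` holds; `PivotDichotomy 3` is false unconditionally -/

/-- The rainbow count is the tripartition sum of the rainbow indicator. [this work] -/
theorem rainbowSum_eq_tripSum {k : ℕ} (S : Finset α) (f : Finset α → Lab k) :
    rainbowSum S f = tripSum S (fun W X Y => rainbow (f W) (f X) (f Y)) := rfl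

/-- The side sum `3S_a` is the tripartition sum of `[f W = a]·3κ(f X, f Y)`. [this work] -/
theorem sideSum_eq_tripSum {k : ℕ} (S : Finset α) (f : Finset α → Lab k) (a : Lab k) :
    sideSum S f a = tripSum S (fun W X Y => if f W = a then 3 * kappa (f X) (f Y) else 0) := by
  unfold sideSum tripSum antipodalSum
  rw [sum_filter]
  refine sum_congr rfl fun W _ => ?_
  beta_reduce
  by_cases h : f W = a
  · simp [h, mul_sum]
  · simp [h]

/-- **THEOREM: the OR-block calculus identity `OrBlockCalculus` holds.**  For pairwise disjoint nonempty blocks, the rainbow count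
and both side sums of the OR-composite `orComposite m B F₀` on `⋃ B j` are the exchangeable-weight functionals of the base `F₀` at the
OR-block statistics `orStat |B j|`. [this work] -/
theorem orBlockCalculus_holds : OrBlockCalculus := by
  intro k m B F₀ hdisj hne
  refine ⟨?_, fun a => ?_⟩
  · rw [rainbowSum_eq_tripSum]
    exact tripSum_orComposite_eq m B hdisj hne (fun x y z => rainbow (F₀ x) (F₀ y) (F₀ z))
  · rw [sideSum_eq_tripSum]
    refine (tripSum_orComposite_eq m B hdisj hne
      (fun x y z => if F₀ x = a then 3 * kappa (F₀ y) (F₀ z) else 0)).trans ?_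
    unfold wSideSumInt
    refine sum_congr rfl fun x _ => sum_congr rfl fun y _ => sum_congr rfl fun z _ => ?_
    split_ifs <;> simp

/-- **THEOREM: `¬ PivotDichotomy 3` (unconditional).**  Gen 16's one-payer dichotomy is false: the monotone sunflower labeling
`orComposite 5 blk F0c` on the 19 coordinates `{0,…,18}` has `T = 32 555 232 > 3S_A = 32 511 888 > 3S_B = 30 348 288`
(gen 19's kernel values combined with `orBlockCalculus_holds`). [this work] -/
theorem not_pivotDichotomy_three : ¬ PivotDichotomy 3 :=
  not_pivotDichotomy_three_of_orBlockCalculus orBlockCalculus_holds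

/-! ### 7. The complete picture: `PivotDichotomy k ↔ k ≤ 2` -/

variable {k : ℕ}

/-- Relabeling the petals along a map `ι : Fin 3 → Fin k` (core and outside fixed). [this work] -/
def relab (ι : Fin 3 → Fin k) : Lab 3 → Lab k
  | bot => bot
  | petal i => petal (ι i)
  | top => top

/-- Relabeling preserves the sunflower order. [this work] -/
theorem relab_mono (ι : Fin 3 → Fin k) {a b : Lab 3} (h : a ≤ b) : relab ι a ≤ relab ι b := by
  rw [le_def] at h ⊢
  rcases h with rfl | rfl | rfl
  · exact Or.inl rfl
  · exact Or.inr (Or.inl rfl)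
  · exact Or.inr (Or.inr rfl)

/-- An injective relabeling preserves the pair weight `κ`. [this work] -/
theorem kappa_relab {ι : Fin 3 → Fin k} (hι : Function.Injective ι) (a b : Lab 3) :
    kappa (relab ι a) (relab ι b) = kappa a b := by
  rcases a with _ | i | _ <;> rcases b with _ | j | _ <;> simp [relab, kappa, hι.eq_iff]

/-- An injective relabeling preserves the rainbow indicator. [this work] -/
theorem rainbow_relab {ι : Fin 3 → Fin k} (hι : Function.Injective ι) (a b c : Lab 3) :
    rainbow (relab ι a) (relab ι b) (relab ι c) = rainbow a b c := by
  rcases a with _ | i | _ <;> rcases b with _ | j | _ <;> rcases c with _ | l | _ <;> simp [relab, rainbow, hι.eq_iff]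

/-- **`PivotDichotomy` descends along petal numbers**: if it holds with `k ≥ 3` petals it holds with `3` (embed the petals). [this work] -/
theorem pivotDichotomy_three_of_le (hk : 3 ≤ k) (h : PivotDichotomy k) : PivotDichotomy 3 := by
  intro S f hf
  set ι : Fin 3 → Fin k := Fin.castLE hk with hι
  have hinj : Function.Injective ι := Fin.castLE_injective hk
  have hg : ∀ ⦃X Y : Finset ℕ⦄, X ⊆ Y → relab ι (f X) ≤ relab ι (f Y) := fun X Y hXY => relab_mono ι (hf hXY)
  have hR : rainbowSum S (fun X => relab ι (f X)) = rainbowSum S f := by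
    unfold rainbowSum; simp only [rainbow_relab hinj]
  have hS : ∀ (a : Lab 3), sideSum S (fun X => relab ι (f X)) (relab ι a) = sideSum S f a := by
    intro a
    unfold sideSum antipodalSum
    simp only [kappa_relab hinj]
    refine sum_congr ?_ fun _ _ => rfl
    ext W
    simp only [mem_filter]
    rcases a with _ | i | _ <;> rcases f W with _ | j | _ <;> simp [relab, hinj.eq_iff]
  rcases h S _ hg with h1 | h1
  · left; rwa [hR, show (top : Lab k) = relab ι top from rfl, hS] at h1
  · right; rwa [hR, show (bot : Lab k) = relab ι bot from rfl, hS] at h1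

/-- With at most two petals there are no rainbows at all. [this work] -/
theorem rainbow_eq_zero_of_le_two (hk : k ≤ 2) (a b c : Lab k) : rainbow a b c = 0 := by
  rcases a with _ | i | _ <;> rcases b with _ | j | _ <;> rcases c with _ | l | _ <;> simp only [rainbow]
  split_ifs with h
  · exfalso
    obtain ⟨h1, h2, h3⟩ := h
    have hcard : Fintype.card (Fin k) ≤ 2 := by simpa using hk
    have : ({i, j, l} : Finset (Fin k)).card ≤ 2 := (card_le_univ _).trans (by simpa using hcard)
    rw [card_insert_of_notMem (by simp [h1, h3]), card_pair h2] at this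
    omega
  · rfl

/-- **THEOREM (the complete picture).**  The one-payer dichotomy `PivotDichotomy k` holds exactly for `k ≤ 2` petals (where it is empty:
no rainbows, both sides nonnegative) and FAILS for every `k ≥ 3` (the 19-coordinate OR-composite witness, petals embedded). [this work] -/
theorem pivotDichotomy_iff_le_two : PivotDichotomy k ↔ k ≤ 2 := by
  refine ⟨fun h => ?_, fun hk S f hf => Or.inl ?_⟩
  · by_contra hk
    exact not_pivotDichotomy_three (pivotDichotomy_three_of_le (by omega) h)
  · have hT : rainbowSum S f = 0 :=
      sum_eq_zero fun W _ => sum_eq_zero fun X _ => rainbow_eq_zero_of_le_two hk _ _ _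
    exact hT ▸ sideSum_nonneg S f hf top

end SahiPivotFamily

end Summit.CriticalPhenomena.PercolationContinuityZ3.Theorems
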